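import Mathlib
import Summits.Ventures.PercRepro2.TypedSepThreeSort
import Summits.Ventures.PercRepro2.TypedSepThreeSupport
import Summits.Ventures.PercRepro2.TypedSepThreeSym
import Summits.Ventures.PercRepro2.RootCutTheorem
import Summits.Ventures.PercRepro2.TypedSwapRoots

/-!
# The typed (SEP-3) zero, IV: the theorem (blind cell PercRepro2, p3 g6, 2026-08-25;
`proofs/P3-BRIDGE.md` §11.20, the typed shadow of `proofs/LEAD-SEP3.md` §1)

On a split support (`Split`: the doors `a₁, a₃` separate the o-side from the b-side) the kernel
`K₃` is a side kernel: `K₃ x y w = KB (glued s₁ t₁) (glued s₂ t₂) (glued s₃ t₃)` with `s_k`, `t_k`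
the side states of the o- and b-restrictions (`K3_eq_side`).  Its doubly symmetrised form is
`dsym`, which vanishes identically (`dsym_eq_zero`), so by `typedCount_side_eq_zero` **every typed
base vanishes**: `typedCount_eq_zero_of_split`, the `z ≡ false` class `HasSepThree` with
`typedCount_eq_zero_of_hasSepThree`, and the mirror class (doors `a₂, a₃`) by the root symmetry.

THE MECHANISM, for NEG-150's reading («a further class theorem needs a NON-POINTWISE mechanism — an
identity, an induction, or an injection between state triples»): an IDENTITY across the separator —
`36 · typedCount (sideKernel Φ) = typedCount (sideKernel (symB (symA Φ)))` (each side's copies may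
be permuted on their own, `TypedSepThreeSym.lean`), followed by the pointwise vanishing of the
`S₃ × S₃`-symmetrised kernel `dsym` (`TypedSepThreeStates.lean`); the 6-fold diagonal symmetrisation
of the pointwise-on-states method does NOT vanish here.  Own work; standard axioms.
-/

namespace Summit.Ventures.PercRepro2

open UnionCluster

namespace CovForm

namespace SepThree

open OneTyped TypedA3 Untouched TypedFactor Separated RootBridge

section Main

open Classical

variable {V : Type*} {E : Type*} [Fintype E] [DecidableEq E] {R : Type*} [Field R]
  [LinearOrder R] [IsStrictOrderedRing R]
variable (ends : E → Sym2 V) (o a₁ a₂ a₃ b : V)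

/-- The kernel on the side restrictions: `KB` on the glued side states. -/
noncomputable def sideΦ (WO WB : Set V) :
    Config E → Config E → Config E → Config E → Config E → Config E → R :=
  fun xa ya wa xb yb wb =>
    ((KB (glued (oSt ends o a₁ a₃ WO xa) (bSt ends a₁ a₂ a₃ b WB xb))
      (glued (oSt ends o a₁ a₃ WO ya) (bSt ends a₁ a₂ a₃ b WB yb))
      (glued (oSt ends o a₁ a₃ WO wa) (bSt ends a₁ a₂ a₃ b WB wb)) : ℤ) : R)

variable {ends o a₁ a₂ a₃ b}

omit [Fintype E] [LinearOrder R] [IsStrictOrderedRing R] in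
/-- The side states only see the side's typed edges. -/
lemma oSt_restr (WO : Set V) {F : Finset E} {z x : Config E} (hx : ∀ e, e ∉ F → x e = z e) :
    oSt ends o a₁ a₃ WO (restr (sideF ends WO F) z x) = oSt ends o a₁ a₃ WO x := by
  unfold oSt
  rw [withinRestr_restr_eq ends WO hx]

omit [Fintype E] [LinearOrder R] [IsStrictOrderedRing R] in
/-- The side states only see the side's typed edges. -/
lemma bSt_restr (WB : Set V) {F : Finset E} {z x : Config E} (hx : ∀ e, e ∉ F → x e = z e) :
    bSt ends a₁ a₂ a₃ b WB (restr (sideF ends WB F) z x) = bSt ends a₁ a₂ a₃ b WB x := by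
  unfold bSt
  rw [withinRestr_restr_eq ends WB hx]

omit [Fintype E] [LinearOrder R] [IsStrictOrderedRing R] in
/-- **`K₃` on the support of a split is a side kernel.** -/
theorem K3_eq_side {WO WB : Set V} {F : Finset E} {z : Config E}
    (h : Split ends o a₁ a₂ a₃ b WO WB F z) {x y w : Config E}
    (hx : ∀ e, e ∉ F → x e = z e) (hy : ∀ e, e ∉ F → y e = z e) (hw : ∀ e, e ∉ F → w e = z e) :
    (K3 ends o a₁ a₂ a₃ b x y w : R) =
      sideKernel (sideF ends WO F) (sideF ends WB F) z (sideΦ ends o a₁ a₂ a₃ b WO WB) x y w := by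
  rw [K3_eq_KB, st_eq_sepSt h (le_zF hx), st_eq_sepSt h (le_zF hy), st_eq_sepSt h (le_zF hw)]
  unfold sideKernel sideΦ
  rw [oSt_restr WO hx, oSt_restr WO hy, oSt_restr WO hw, bSt_restr WB hx, bSt_restr WB hy,
    bSt_restr WB hw]

omit [Fintype E] [DecidableEq E] [LinearOrder R] [IsStrictOrderedRing R] in
/-- The doubly symmetrised side kernel is `dsym` on the side states. -/
lemma symB_symA_sideΦ (WO WB : Set V) (xa ya wa xb yb wb : Config E) :
    symB (symA (sideΦ ends o a₁ a₂ a₃ b WO WB)) xa ya wa xb yb wb =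
      ((dsym (oSt ends o a₁ a₃ WO xa) (oSt ends o a₁ a₃ WO ya) (oSt ends o a₁ a₃ WO wa)
        (bSt ends a₁ a₂ a₃ b WB xb) (bSt ends a₁ a₂ a₃ b WB yb)
        (bSt ends a₁ a₂ a₃ b WB wb) : ℤ) : R) := by
  unfold symB symA sideΦ dsym psi
  push_cast
  ring

omit [Fintype E] [DecidableEq E] [LinearOrder R] [IsStrictOrderedRing R] in
/-- The doubly symmetrised side kernel vanishes. -/
lemma symB_symA_sideΦ_eq_zero (WO WB : Set V) (xa ya wa xb yb wb : Config E) :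
    symB (symA (sideΦ ends o a₁ a₂ a₃ b WO WB)) xa ya wa xb yb wb = (0 : R) := by
  rw [symB_symA_sideΦ, dsym_eq_zero _ _ _ _ _ _ (validO_oSt WO xa) (validO_oSt WO ya)
    (validO_oSt WO wa) (validB_bSt WB xb) (validB_bSt WB yb) (validB_bSt WB wb)]
  simp

/-- **THE TYPED (SEP-3) ZERO**: on a split support — the doors `a₁, a₃` separate `o` from `a₂`
and `b` — every typed base of `K₃` vanishes, for every pinning `z` and every type map with values
in `{1, 2}` on `F`. -/
theorem typedCount_eq_zero_of_split {WO WB : Set V} (F : Finset E) (z : Config E) (τ : E → ℕ)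
    (h : Split ends o a₁ a₂ a₃ b WO WB F z) :
    typedCount F z τ (K3 ends o a₁ a₂ a₃ b : Config E → Config E → Config E → R) = 0 := by
  set A := sideF ends WO F with hA
  set B := sideF ends WB F with hB
  have hAF : A ⊆ F := Finset.filter_subset _ _
  have hBF : B ⊆ F := Finset.filter_subset _ _
  have hAB : Disjoint A B := by
    rw [Finset.disjoint_left]
    intro e heA heB
    simp only [hA, hB, sideF, Finset.mem_filter] at heA heB
    exact h.noloop e heA.1 ⟨heA.2, heB.2⟩
  have hker : typedCount F z τ (K3 ends o a₁ a₂ a₃ b : Config E → Config E → Config E → R) =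
      typedCount F z τ (sideKernel A B z (sideΦ ends o a₁ a₂ a₃ b WO WB)) := by
    refine typedCount_congr_on_support F z τ fun x y w hc _ => ?_
    exact K3_eq_side h (fun e he => (hc e he).1) (fun e he => (hc e he).2.1)
      (fun e he => (hc e he).2.2)
  rw [hker]
  exact typedCount_side_eq_zero F hAF hBF hAB z τ _
    (fun xa ya wa xb yb wb => symB_symA_sideΦ_eq_zero WO WB xa ya wa xb yb wb)

variable (ends o a₁ a₂ a₃ b)

/-- **The class of the typed graph `(V, F)`**: the doors `a₁, a₃` separate `o` from `{a₂, b}`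
(no hypothesis on the sides beyond the split). -/
def HasSepThree (F : Finset E) : Prop :=
  ∃ WO WB : Set V, Split ends o a₁ a₂ a₃ b WO WB F (fun _ => false)

/-- **Every typed base vanishes on `HasSepThree` at `z ≡ false`** — an exact-zero conjunct for the
residual domain. -/
theorem typedCount_eq_zero_of_hasSepThree (F : Finset E) (τ : E → ℕ)
    (h : HasSepThree ends o a₁ a₂ a₃ b F) :
    typedCount F (fun _ => false) τ
      (K3 ends o a₁ a₂ a₃ b : Config E → Config E → Config E → R) = 0 := by
  obtain ⟨WO, WB, hs⟩ := h
  exact typedCount_eq_zero_of_split F _ τ hs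

/-- **The mirror class** (the doors `a₂, a₃` separate `o` from `{a₁, b}`), by the root symmetry. -/
theorem typedCount_eq_zero_of_hasSepThree_mirror (F : Finset E) (τ : E → ℕ)
    (h : HasSepThree ends o a₂ a₁ a₃ b F) :
    typedCount F (fun _ => false) τ
      (K3 ends o a₁ a₂ a₃ b : Config E → Config E → Config E → R) = 0 := by
  rw [← SwapRoots.typedCount_swap_roots]
  exact typedCount_eq_zero_of_hasSepThree ends o a₂ a₁ a₃ b F τ h

/-- Row 2′TRI (nonnegativity) on the class, as a consequence of the exact zero. -/
theorem typedCount_nonneg_of_hasSepThree (F : Finset E) (τ : E → ℕ)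
    (h : HasSepThree ends o a₁ a₂ a₃ b F) :
    0 ≤ typedCount F (fun _ => false) τ
      (K3 ends o a₁ a₂ a₃ b : Config E → Config E → Config E → R) :=
  le_of_eq (typedCount_eq_zero_of_hasSepThree ends o a₁ a₂ a₃ b F τ h).symm

end Main

end SepThree

end CovForm

end Summit.Ventures.PercRepro2
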